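import Mathlib.Analysis.Complex.Basic
import Mathlib.Analysis.Calculus.FDeriv.Symmetric
import Mathlib.Analysis.Calculus.FDeriv.CompCLM
import Mathlib.Analysis.Calculus.ContDiff.Operations
import Mathlib.Analysis.Normed.Operator.BoundedLinearMaps
import HarnessLib

/-!
# Commutative holomorphic local group laws: the Maurer–Cartan form is closed

Topic `Analysis/Calculus`; namespace `Literature.Analysis.Calculus`. One `Prop`-valued structure and
theorems; no named fact.

A **commutative holomorphic local group law** at a point `c` of a complex Banach space `E` is a
map `m : E → E → E`, analytic near `(c, c)`, with `m a c = a` near `c`, associative near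
`(c, c, c)` and commutative near `(c, c)` (`IsCommHolomorphicLocalGroupLaw m c`; the conditions are
`Filter.Eventually` statements, so only the germ of `m` matters). The example this file is written
for is the group law of a commutative complex Lie group read in a chart at the identity
(`Literature/Geometry/Kaehler/CompactComplexLieGroupExp.lean`), but nothing here mentions
manifolds.

For such an `m` we study the translation derivatives `A y = fderiv ℂ (m y) c : E →L[ℂ] E` and the
`(E →L[ℂ] E)`-valued **Maurer–Cartan form** `ω y = (A y)⁻¹` (the left-invariant `E`-valued
`1`-form normalised to the identity at the unit), and prove, by differentiating the axioms:

* `eventually_fderiv_transl_mul` — associativity differentiated at the unit: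
  `A (m x y) = fderiv (m x) y ∘ A y` near `(c, c)`; hence `A y` is invertible near `c`
  (`eventually_isInvertible`), `ω` is analytic near `c` (`eventually_contDiffAt_mc`) and
  **invariant under the translations** `m x ·`: `ω (m x z) ∘ fderiv (m x) z = ω z`
  (`eventually_mc_comp_fderiv`);
* `fderiv_mc_symm_self` — commutativity differentiated twice at the unit, with the symmetry of
  second derivatives (`ContDiffAt.isSymmSndFDerivAt`): the derivative of `ω` at `c` is a symmetric
  bilinear map, i.e. `dω = 0` at the unit;
* `eventually_fderiv_mc_symm` — **`ω` is closed near the unit**: the symmetry of `fderiv ℂ ω x` at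
  every `x` near `c`, transported from `c` along the translation `m x ·` by the invariance
  relation (the exterior derivative commutes with pull-backs; here a two-line computation with
  the symmetric second derivative of `m x ·`).

The pay-off is in `Literature/Analysis/Calculus/CommutativeLocalGroupLog.lean`: a primitive of the
closed form `ω` (Poincaré lemma) is a **local logarithm** `L`, `L (m x y) = L x + L y`, i.e.
canonical coordinates in which the law is addition — the classical first step of "a connected
compact complex Lie group is a complex torus" (Mumford, *Abelian Varieties*, §1; Lange, *Abelian
Varieties over the Complex Numbers*, Lemma 1.1.2), obtained here without Lie algebras, one-parameter
subgroups or ODEs. Over `ℝ` and in class `C²` the same computation holds verbatim; only the complex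
analytic case is recorded, which is what the tree consumes.

## References

* C. Chevalley, *Theory of Lie Groups* (1946), Ch. IV §VIII (canonical coordinates), Ch. V §IV
  (forms of Maurer–Cartan: left invariance eq. (4), structure equations (2)–(3)). [Chevalley1946]
* N. Bourbaki, *Groupes et algèbres de Lie*, Ch. III §1 no. 10 (Lie group germs).
  [Bourbaki2006LieGroups23]
* D. Mumford, *Abelian Varieties* (1970), §1 (compact complex Lie groups; the exponential map of a
  commutative complex Lie group). [MumfordAV1970]
* H. Lange, *Abelian Varieties over the Complex Numbers*, Grundlehren Text Editions (2023),
  Lemma 1.1.2. [Lange2023AbelianVarietiesComplex]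
-/

noncomputable section

open Set Filter Function ContinuousLinearMap Metric
open scoped Topology ContDiff

namespace Literature.Analysis.Calculus

variable {E : Type*} [NormedAddCommGroup E] [NormedSpace ℂ E]

/-- A **commutative holomorphic local group law** at `c`: a map `m : E → E → E` on a complex normed
space which is analytic near `(c, c)`, has `c` as a right unit near `c`, and is associative and
commutative near `(c, c, c)` resp. `(c, c)` (all conditions `Filter.Eventually`). The chart
expression of the group law of a commutative complex Lie group in a chart at the identity is the
example (a commutative complex-analytic *Lie group germ*, Bourbaki, *Lie*, Ch. III §1 no. 10, in
the germ-at-`(c, c)` form). [cite: Bourbaki2006LieGroups23, Ch. III §1 no. 10] -/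
structure IsCommHolomorphicLocalGroupLaw (m : E → E → E) (c : E) : Prop where
  /-- `(x, y) ↦ m x y` is analytic near `(c, c)`. -/
  contDiffAt : ContDiffAt ℂ ω (uncurry m) (c, c)
  /-- `c` is a right unit near `c`. -/
  right_id : ∀ᶠ a in 𝓝 c, m a c = a
  /-- associativity near `(c, c, c)`. -/
  assoc : ∀ᶠ p : E × E × E in 𝓝 (c, c, c), m (m p.1 p.2.1) p.2.2 = m p.1 (m p.2.1 p.2.2)
  /-- commutativity near `(c, c)`. -/
  comm : ∀ᶠ p : E × E in 𝓝 (c, c), m p.1 p.2 = m p.2 p.1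

namespace IsCommHolomorphicLocalGroupLaw

variable {m : E → E → E} {c : E}

/-! ### Units, continuity, partial derivatives -/

/-- `m c c = c`. [folklore] -/
private theorem apply_self (h : IsCommHolomorphicLocalGroupLaw m c) : m c c = c :=
  h.right_id.self_of_nhds

/-- `c` is also a left unit near `c` (commutativity). [folklore] -/
private theorem left_id (h : IsCommHolomorphicLocalGroupLaw m c) : ∀ᶠ b in 𝓝 c, m c b = b := by
  have h1 : ∀ᶠ b in 𝓝 c, m c b = m b c :=
    ((Continuous.prodMk_right c).continuousAt (x := c)).eventually h.comm
  filter_upwards [h1, h.right_id] with b hb hb'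
  rw [hb, hb']

/-- `m` is analytic at every point near `(c, c)`. [folklore] -/
private theorem eventually_contDiffAt (h : IsCommHolomorphicLocalGroupLaw m c) :
    ∀ᶠ p : E × E in 𝓝 (c, c), ContDiffAt ℂ ω (uncurry m) p :=
  h.contDiffAt.eventually (by simp)

/-- `m` tends to `c` at `(c, c)`. [cite: Bourbaki2006LieGroups23, Ch. III §1 no. 10] -/
theorem tendsto_nhds (h : IsCommHolomorphicLocalGroupLaw m c) :
    Tendsto (uncurry m) (𝓝 (c, c)) (𝓝 c) := by
  have := h.contDiffAt.continuousAt.tendsto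
  rwa [uncurry_apply_pair, h.apply_self] at this

/-- The partial derivative of `m` in the second variable is the full derivative composed with the
inclusion of the second factor. [folklore] -/
private theorem hasFDerivAt_snd {p : E × E} (hp : ContDiffAt ℂ ω (uncurry m) p) :
    HasFDerivAt (m p.1) ((fderiv ℂ (uncurry m) p).comp (inr ℂ E E)) p.2 := by
  have hM : HasFDerivAt (uncurry m) (fderiv ℂ (uncurry m) p) (p.1, p.2) :=
    (hp.differentiableAt (by simp)).hasFDerivAt
  have hi : HasFDerivAt (fun b : E ↦ (p.1, b)) (inr ℂ E E) p.2 :=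
    (hasFDerivAt_const p.1 p.2).prodMk (hasFDerivAt_id p.2)
  exact hM.comp p.2 hi

/-- Near `(c, c)`, `b ↦ m x b` is differentiable at `y` with derivative `fderiv ℂ (m x) y`.
[cite: Bourbaki2006LieGroups23, Ch. III §1 no. 10] -/
theorem eventually_hasFDerivAt_snd (h : IsCommHolomorphicLocalGroupLaw m c) :
    ∀ᶠ p : E × E in 𝓝 (c, c), HasFDerivAt (m p.1) (fderiv ℂ (m p.1) p.2) p.2 := by
  filter_upwards [h.eventually_contDiffAt] with p hp
  exact (hasFDerivAt_snd hp).differentiableAt.hasFDerivAt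

/-- `(x, y) ↦ fderiv ℂ (m x) y` is analytic wherever `m` is. [folklore] -/
private theorem contDiffAt_fderiv_snd {p : E × E} (hp : ContDiffAt ℂ ω (uncurry m) p) :
    ContDiffAt ℂ ω (fun q : E × E ↦ fderiv ℂ (m q.1) q.2) p := by
  have h1 : ContDiffAt ℂ ω (fun q : E × E ↦ (fderiv ℂ (uncurry m) q).comp (inr ℂ E E)) p :=
    (hp.fderiv_right (m := ω) le_rfl).clm_comp contDiffAt_const
  refine h1.congr_of_eventuallyEq ?_
  filter_upwards [hp.eventually (by simp)] with q hq
  exact (hasFDerivAt_snd hq).fderiv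

/-- The derivative of translation by the unit is the identity: `fderiv ℂ (m c) c = id`.
[folklore] -/
private theorem fderiv_snd_self (h : IsCommHolomorphicLocalGroupLaw m c) :
    fderiv ℂ (m c) c = ContinuousLinearMap.id ℂ E := by
  have : m c =ᶠ[𝓝 c] id := h.left_id
  rw [this.fderiv_eq, fderiv_id]

/-- `y ↦ fderiv ℂ (m y) c` (the derivative at the unit of the translation by `y`) is analytic near
`c`. [folklore] -/
private theorem eventually_contDiffAt_transl (h : IsCommHolomorphicLocalGroupLaw m c) :
    ∀ᶠ y in 𝓝 c, ContDiffAt ℂ ω (fun y ↦ fderiv ℂ (m y) c) y := by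
  have ht : Tendsto (fun y : E ↦ (y, c)) (𝓝 c) (𝓝 (c, c)) :=
    (Continuous.prodMk_left c).continuousAt
  filter_upwards [ht.eventually h.eventually_contDiffAt] with y hy
  exact (contDiffAt_fderiv_snd hy).comp y (contDiffAt_id.prodMk contDiffAt_const)

/-! ### Associativity differentiated: the fundamental relation of the translation derivatives -/

/-- Associativity near `(c, c, c)` in the form: for `(x, y)` near `(c, c)` and `z` near `c`,
`m (m x y) z = m x (m y z)`. [folklore] -/
private theorem eventually_eventually_assoc (h : IsCommHolomorphicLocalGroupLaw m c) :
    ∀ᶠ p : E × E in 𝓝 (c, c), ∀ᶠ z in 𝓝 c, m (m p.1 p.2) z = m p.1 (m p.2 z) := by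
  have ht : Tendsto (fun q : (E × E) × E ↦ (q.1.1, q.1.2, q.2)) (𝓝 ((c, c), c)) (𝓝 (c, c, c)) :=
    (by fun_prop : Continuous fun q : (E × E) × E ↦ (q.1.1, q.1.2, q.2)).continuousAt
  have := ht.eventually h.assoc
  rw [nhds_prod_eq (x := (c, c))] at this
  exact this.curry

/-- **Translation derivatives compose**: near `(c, c)`,
`fderiv (m (m x y)) c = fderiv (m x) y ∘ fderiv (m y) c` (differentiate
`z ↦ m (m x y) z = m x (m y z)` at the unit). [cite: Chevalley1946, Ch. V §IV eq. (4)] -/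
theorem eventually_fderiv_transl_mul (h : IsCommHolomorphicLocalGroupLaw m c) :
    ∀ᶠ p : E × E in 𝓝 (c, c),
      fderiv ℂ (m (m p.1 p.2)) c = (fderiv ℂ (m p.1) p.2).comp (fderiv ℂ (m p.2) c) := by
  have t1 : Tendsto (fun p : E × E ↦ (uncurry m p, c)) (𝓝 (c, c)) (𝓝 (c, c)) :=
    h.tendsto_nhds.prodMk_nhds tendsto_const_nhds
  have t2 : Tendsto (fun p : E × E ↦ (p.2, c)) (𝓝 (c, c)) (𝓝 (c, c)) :=
    (by fun_prop : Continuous fun p : E × E ↦ (p.2, c)).continuousAt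
  have t3 : Tendsto (fun p : E × E ↦ p.2) (𝓝 (c, c)) (𝓝 c) := continuous_snd.continuousAt
  filter_upwards [h.eventually_eventually_assoc, t1.eventually h.eventually_contDiffAt,
    t2.eventually h.eventually_contDiffAt, h.eventually_contDiffAt,
    t3.eventually h.right_id] with p hassoc h1 h2 h3 hyc
  -- `z ↦ m x (m y z)`
  have hy : HasFDerivAt (m p.2) (fderiv ℂ (m p.2) c) c :=
    (hasFDerivAt_snd h2).differentiableAt.hasFDerivAt
  have hx : HasFDerivAt (m p.1) (fderiv ℂ (m p.1) p.2) (m p.2 c) := by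
    rw [hyc]
    exact (hasFDerivAt_snd h3).differentiableAt.hasFDerivAt
  have H1 : HasFDerivAt (fun z ↦ m p.1 (m p.2 z))
      ((fderiv ℂ (m p.1) p.2).comp (fderiv ℂ (m p.2) c)) c := hx.comp c hy
  -- `z ↦ m (m x y) z`
  have H2 : HasFDerivAt (m (m p.1 p.2)) (fderiv ℂ (m (m p.1 p.2)) c) c :=
    (hasFDerivAt_snd h1).differentiableAt.hasFDerivAt
  have H2' : HasFDerivAt (fun z ↦ m p.1 (m p.2 z)) (fderiv ℂ (m (m p.1 p.2)) c) c :=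
    H2.congr_of_eventuallyEq (hassoc.mono fun z hz ↦ hz.symm)
  exact H2'.unique H1

/-- The Maurer–Cartan form at the unit is the identity. [cite: Chevalley1946, Ch. V §IV] -/
theorem mc_self (h : IsCommHolomorphicLocalGroupLaw m c) :
    (fderiv ℂ (m c) c).inverse = ContinuousLinearMap.id ℂ E := by
  rw [h.fderiv_snd_self, inverse_id]

variable [CompleteSpace E]

/-- The translation derivatives `fderiv ℂ (m y) c` are invertible for `y` near `c`. [folklore] -/
private theorem eventually_isInvertible (h : IsCommHolomorphicLocalGroupLaw m c) :
    ∀ᶠ y in 𝓝 c, (fderiv ℂ (m y) c).IsInvertible := by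
  have hc : ContinuousAt (fun y ↦ fderiv ℂ (m y) c) c :=
    h.eventually_contDiffAt_transl.self_of_nhds.continuousAt
  have hn : range ((↑) : (E ≃L[ℂ] E) → E →L[ℂ] E) ∈ 𝓝 (fderiv ℂ (m c) c) := by
    rw [h.fderiv_snd_self]
    exact ContinuousLinearEquiv.nhds (ContinuousLinearEquiv.refl ℂ E)
  filter_upwards [hc.preimage_mem_nhds hn] with y hy
  obtain ⟨e, he⟩ := hy
  exact ⟨e, he⟩

/-- The **Maurer–Cartan form** `y ↦ (fderiv ℂ (m y) c)⁻¹` is analytic near `c`. [cite: Chevalley1946, Ch. V §IV] -/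
theorem eventually_contDiffAt_mc (h : IsCommHolomorphicLocalGroupLaw m c) :
    ∀ᶠ y in 𝓝 c, ContDiffAt ℂ ω (fun y ↦ (fderiv ℂ (m y) c).inverse) y := by
  filter_upwards [h.eventually_isInvertible, h.eventually_contDiffAt_transl] with y hy hy'
  exact hy.contDiffAt_map_inverse.comp y hy'

/-- **Invariance of the Maurer–Cartan form under translations**: near `(c, c)`,
`(fderiv (m (m x z)) c)⁻¹ ∘ fderiv (m x) z = (fderiv (m z) c)⁻¹`. [cite: Chevalley1946, Ch. V §IV eq. (4)] -/
theorem eventually_mc_comp_fderiv (h : IsCommHolomorphicLocalGroupLaw m c) :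
    ∀ᶠ p : E × E in 𝓝 (c, c),
      (fderiv ℂ (m (m p.1 p.2)) c).inverse.comp (fderiv ℂ (m p.1) p.2) =
        (fderiv ℂ (m p.2) c).inverse := by
  have t3 : Tendsto (fun p : E × E ↦ p.2) (𝓝 (c, c)) (𝓝 c) := continuous_snd.continuousAt
  filter_upwards [h.eventually_fderiv_transl_mul,
    h.tendsto_nhds.eventually h.eventually_isInvertible, t3.eventually h.eventually_isInvertible]
    with p hp h1 h2
  have e1 : ((fderiv ℂ (m (m p.1 p.2)) c).inverse.comp (fderiv ℂ (m p.1) p.2)).comp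
      (fderiv ℂ (m p.2) c) = ContinuousLinearMap.id ℂ E := by
    rw [ContinuousLinearMap.comp_assoc, ← hp]
    exact h1.inverse_comp_self
  calc (fderiv ℂ (m (m p.1 p.2)) c).inverse.comp (fderiv ℂ (m p.1) p.2)
      = (((fderiv ℂ (m (m p.1 p.2)) c).inverse.comp (fderiv ℂ (m p.1) p.2)).comp
          (fderiv ℂ (m p.2) c)).comp (fderiv ℂ (m p.2) c).inverse := by
        rw [ContinuousLinearMap.comp_assoc, h2.self_comp_inverse, ContinuousLinearMap.comp_id]
    _ = (fderiv ℂ (m p.2) c).inverse := by rw [e1, ContinuousLinearMap.id_comp]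

/-! ### The Maurer–Cartan form is closed: symmetry of its derivative -/

omit [CompleteSpace E] in
/-- The derivative at `c` of `y ↦ fderiv (m y) c`, evaluated: a mixed second partial derivative of
`m` at `(c, c)`. [folklore] -/
private theorem fderiv_transl_apply (h : IsCommHolomorphicLocalGroupLaw m c) (v w : E) :
    fderiv ℂ (fun y ↦ fderiv ℂ (m y) c) c v w =
      fderiv ℂ (fderiv ℂ (uncurry m)) (c, c) (v, 0) (0, w) := by
  have hG : (fun y ↦ fderiv ℂ (m y) c) =ᶠ[𝓝 c]
      fun y ↦ (fderiv ℂ (uncurry m) (y, c)).comp (inr ℂ E E) := by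
    have ht : Tendsto (fun y : E ↦ (y, c)) (𝓝 c) (𝓝 (c, c)) :=
      (Continuous.prodMk_left c).continuousAt
    filter_upwards [ht.eventually h.eventually_contDiffAt] with y hy
    exact (hasFDerivAt_snd hy).fderiv
  rw [hG.fderiv_eq]
  have hD : HasFDerivAt (fderiv ℂ (uncurry m)) (fderiv ℂ (fderiv ℂ (uncurry m)) (c, c)) (c, c) :=
    ((h.contDiffAt.fderiv_right (m := ω) le_rfl).differentiableAt (by simp)).hasFDerivAt
  have hf : HasFDerivAt (fun y : E ↦ (y, c)) ((ContinuousLinearMap.id ℂ E).prod 0) c :=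
    (hasFDerivAt_id c).prodMk (hasFDerivAt_const c c)
  have h1 : HasFDerivAt (fun y : E ↦ fderiv ℂ (uncurry m) (y, c))
      ((fderiv ℂ (fderiv ℂ (uncurry m)) (c, c)).comp ((ContinuousLinearMap.id ℂ E).prod 0)) c :=
    hD.comp (f := fun y : E ↦ (y, c)) c hf
  have h2 := h1.clm_comp (hasFDerivAt_const (inr ℂ E E) c)
  rw [h2.fderiv]
  simp [compL_apply]

omit [CompleteSpace E] in
/-- Commutativity differentiated twice: the second derivative of `m` at `(c, c)` is invariant under
exchanging the factors. [folklore] -/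
private theorem fderiv_fderiv_swap (h : IsCommHolomorphicLocalGroupLaw m c) (u u' : E × E) :
    fderiv ℂ (fderiv ℂ (uncurry m)) (c, c) u u' =
      fderiv ℂ (fderiv ℂ (uncurry m)) (c, c) u.swap u'.swap := by
  set σ : (E × E) ≃L[ℂ] (E × E) := ContinuousLinearEquiv.prodComm ℂ E E with hσ
  -- `M = M ∘ σ` near `(c, c)`
  have hcomm : uncurry m =ᶠ[𝓝 (c, c)] (uncurry m ∘ σ) := by
    filter_upwards [h.comm] with p hp
    obtain ⟨x, y⟩ := p
    simpa [hσ] using hp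
  -- first derivatives near `(c, c)`
  have hσc : σ (c, c) = (c, c) := rfl
  have hD1 : ∀ᶠ q in 𝓝 (c, c), fderiv ℂ (uncurry m ∘ σ) q =
      (fderiv ℂ (uncurry m) (σ q)).comp (σ : E × E →L[ℂ] E × E) := by
    have ht : Tendsto σ (𝓝 (c, c)) (𝓝 (c, c)) := by
      have := σ.continuous.continuousAt (x := (c, c))
      rwa [ContinuousAt, hσc] at this
    filter_upwards [ht.eventually h.eventually_contDiffAt] with q hq
    exact ((hq.differentiableAt (by simp)).hasFDerivAt.comp q σ.hasFDerivAt).fderiv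
  have hE : fderiv ℂ (fderiv ℂ (uncurry m)) (c, c) = fderiv ℂ (fderiv ℂ (uncurry m ∘ σ)) (c, c) :=
    (hcomm.fderiv (𝕜 := ℂ)).fderiv_eq (𝕜 := ℂ)
  -- second derivative of `M ∘ σ` at `(c, c)`
  have hD :
      HasFDerivAt (fderiv ℂ (uncurry m)) (fderiv ℂ (fderiv ℂ (uncurry m)) (c, c)) (σ (c, c)) :=
    ((h.contDiffAt.fderiv_right (m := ω) le_rfl).differentiableAt (by simp)).hasFDerivAt
  have h1 : HasFDerivAt (fun q ↦ fderiv ℂ (uncurry m) (σ q))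
      ((fderiv ℂ (fderiv ℂ (uncurry m)) (c, c)).comp (σ : E × E →L[ℂ] E × E)) (c, c) :=
    hD.comp (c, c) σ.hasFDerivAt
  have h2 := h1.clm_comp (hasFDerivAt_const (σ : E × E →L[ℂ] E × E) (c, c))
  have h3 : fderiv ℂ (fderiv ℂ (uncurry m ∘ σ)) (c, c) =
      fderiv ℂ (fun q ↦ (fderiv ℂ (uncurry m) (σ q)).comp (σ : E × E →L[ℂ] E × E)) (c, c) :=
    (EventuallyEq.fderiv_eq hD1)
  conv_lhs => rw [hE, h3, h2.fderiv]
  simp [compL_apply, hσ]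

omit [CompleteSpace E] in
/-- The derivative at `c` of the translation derivatives is symmetric (a consequence of
commutativity and of the symmetry of second derivatives). [folklore] -/
private theorem fderiv_transl_symm (h : IsCommHolomorphicLocalGroupLaw m c) (v w : E) :
    fderiv ℂ (fun y ↦ fderiv ℂ (m y) c) c v w = fderiv ℂ (fun y ↦ fderiv ℂ (m y) c) c w v := by
  rw [h.fderiv_transl_apply, h.fderiv_transl_apply, h.fderiv_fderiv_swap]
  have hs : IsSymmSndFDerivAt ℂ (uncurry m) (c, c) := h.contDiffAt.isSymmSndFDerivAt (by simp)
  simpa using hs (0, v) (w, 0)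

/-- **The Maurer–Cartan form is closed at the unit**: the derivative at `c` of
`y ↦ (fderiv (m y) c)⁻¹` is symmetric. [folklore] -/
private theorem fderiv_mc_symm_self (h : IsCommHolomorphicLocalGroupLaw m c) (v w : E) :
    fderiv ℂ (fun y ↦ (fderiv ℂ (m y) c).inverse) c v w =
      fderiv ℂ (fun y ↦ (fderiv ℂ (m y) c).inverse) c w v := by
  set A : E → E →L[ℂ] E := fun y ↦ fderiv ℂ (m y) c with hA
  set Ω : E → E →L[ℂ] E := fun y ↦ (fderiv ℂ (m y) c).inverse with hΩ
  have hAd : HasFDerivAt A (fderiv ℂ A c) c :=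
    (h.eventually_contDiffAt_transl.self_of_nhds.differentiableAt (by simp)).hasFDerivAt
  have hΩd : HasFDerivAt Ω (fderiv ℂ Ω c) c :=
    (h.eventually_contDiffAt_mc.self_of_nhds.differentiableAt (by simp)).hasFDerivAt
  -- `Ω y ∘ A y = id` near `c`, so its derivative vanishes
  have hconst : (fun y ↦ (Ω y).comp (A y)) =ᶠ[𝓝 c] fun _ ↦ ContinuousLinearMap.id ℂ E := by
    filter_upwards [h.eventually_isInvertible] with y hy
    exact hy.inverse_comp_self
  have hzero : fderiv ℂ (fun y ↦ (Ω y).comp (A y)) c = 0 := by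
    rw [hconst.fderiv_eq, fderiv_const_apply]
  have hprod := (hΩd.clm_comp hAd).fderiv
  rw [hzero] at hprod
  have key : ∀ v w : E, fderiv ℂ Ω c v w = -(fderiv ℂ A c v w) := by
    intro v w
    have := congrArg (fun T : E →L[ℂ] E →L[ℂ] E ↦ T v w) hprod
    simp only [zero_apply, add_apply,
      ContinuousLinearMap.comp_apply, compL_apply, ContinuousLinearMap.flip_apply] at this
    have hAc : A c = ContinuousLinearMap.id ℂ E := h.fderiv_snd_self
    have hΩc : Ω c = ContinuousLinearMap.id ℂ E := h.mc_self
    rw [hAc, hΩc] at this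
    simp only [ContinuousLinearMap.coe_id', id_eq] at this
    exact eq_neg_of_add_eq_zero_right this.symm
  rw [key, key, h.fderiv_transl_symm]

/-- **The Maurer–Cartan form is closed near the unit**: transporting the symmetry at `c` by the
translations `m x ·` (which preserve the form), the derivative of `y ↦ (fderiv (m y) c)⁻¹` is
symmetric at every point near `c`. [cite: Chevalley1946, Ch. V §IV eq. (2)–(3)] -/
theorem eventually_fderiv_mc_symm (h : IsCommHolomorphicLocalGroupLaw m c) :
    ∀ᶠ x in 𝓝 c, ∀ v w : E,
      fderiv ℂ (fun y ↦ (fderiv ℂ (m y) c).inverse) x v w =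
        fderiv ℂ (fun y ↦ (fderiv ℂ (m y) c).inverse) x w v := by
  set Ω : E → E →L[ℂ] E := fun y ↦ (fderiv ℂ (m y) c).inverse with hΩ
  have hinv := h.eventually_mc_comp_fderiv
  rw [nhds_prod_eq] at hinv
  have ht : Tendsto (fun x : E ↦ (x, c)) (𝓝 c) (𝓝 (c, c)) :=
    (Continuous.prodMk_left c).continuousAt
  filter_upwards [hinv.curry, h.eventually_contDiffAt_mc, ht.eventually h.eventually_contDiffAt,
    h.right_id, h.eventually_isInvertible] with x hx hΩx hMx hxc hAx v w
  -- the translation `T = m x`, its derivative `DT = fderiv (m x)`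
  have hTω : ContDiffAt ℂ ω (m x) c :=
    hMx.comp c (contDiffAt_const.prodMk contDiffAt_id)
  have hT : HasFDerivAt (m x) (fderiv ℂ (m x) c) c := (hTω.differentiableAt (by simp)).hasFDerivAt
  have hDT : HasFDerivAt (fun z ↦ fderiv ℂ (m x) z) (fderiv ℂ (fderiv ℂ (m x)) c) c :=
    ((hTω.fderiv_right (m := ω) le_rfl).differentiableAt (by simp)).hasFDerivAt
  have hΩT : HasFDerivAt (fun z ↦ Ω (m x z)) ((fderiv ℂ Ω x).comp (fderiv ℂ (m x) c)) c := by
    have hΩ' : HasFDerivAt Ω (fderiv ℂ Ω x) (m x c) := by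
      rw [hxc]; exact (hΩx.differentiableAt (by simp)).hasFDerivAt
    exact hΩ'.comp c hT
  -- `B z = Ω (m x z) ∘ fderiv (m x) z` agrees with `Ω` near `c`
  have hB := (hΩT.clm_comp hDT).fderiv
  have hBΩ : fderiv ℂ (fun z ↦ (Ω (m x z)).comp (fderiv ℂ (m x) z)) c = fderiv ℂ Ω c :=
    EventuallyEq.fderiv_eq (hx.mono fun z hz ↦ hz)
  rw [hBΩ] at hB
  have hsT : IsSymmSndFDerivAt ℂ (m x) c := hTω.isSymmSndFDerivAt (by simp)
  have key : ∀ v w : E, fderiv ℂ Ω c v w =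
      Ω (m x c) (fderiv ℂ (fderiv ℂ (m x)) c v w) +
        fderiv ℂ Ω x (fderiv ℂ (m x) c v) (fderiv ℂ (m x) c w) := by
    intro v w
    have := congrArg (fun T : E →L[ℂ] E →L[ℂ] E ↦ T v w) hB
    simpa only [add_apply, ContinuousLinearMap.comp_apply, compL_apply,
      ContinuousLinearMap.flip_apply] using this
  have hsym : ∀ v w : E, fderiv ℂ Ω x (fderiv ℂ (m x) c v) (fderiv ℂ (m x) c w) =
      fderiv ℂ Ω x (fderiv ℂ (m x) c w) (fderiv ℂ (m x) c v) := by
    intro v w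
    have e1 := key v w
    have e2 := key w v
    rw [h.fderiv_mc_symm_self v w, hsT v w] at e1
    rw [e1] at e2
    exact add_left_cancel e2
  have := hsym ((fderiv ℂ (m x) c).inverse v) ((fderiv ℂ (m x) c).inverse w)
  simpa only [hAx.self_apply_inverse] using this

end IsCommHolomorphicLocalGroupLaw

end Literature.Analysis.Calculus
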